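import Literature.NumberTheory.ComplexMultiplication.CMOrderLocalMinimalGenerators
import Literature.NumberTheory.ComplexMultiplication.CMOrderInvertibleIdealLocalization
import Mathlib.RingTheory.Ideal.Quotient.Operations
import Mathlib.LinearAlgebra.Dimension.Free
import Mathlib.Algebra.BigOperators.Fin
import HarnessLib

/-!
# The number of generators of a fractional ideal of an order (MARSEGLIA 2024 LEMMA 4.2):
# `gens_R(I) ≤ max {2, max_𝔭 dim_{R/𝔭} I/𝔭I}`, with equality unless `I` is principal; invertible ideals
# are generated by two elements

Family `hodge`, lane `lit-hodgefound` (Track 2 foundations library; seat p15, row g27-#3), topic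
`Literature/NumberTheory/ComplexMultiplication`, namespaces `Literature.NumberTheory.ComplexMultiplication.NumberRing`
(§1: a noetherian one-dimensional domain `R` with fraction field `K`; the printed proof VERBATIM: choice of `b₁`,
the finite set `𝓑`, Chinese-remainder lifting of local spanning sets, local check), `…EndOrder` (§2: the order
`𝔯 = endOrder ρ`) and `…CMTypeLattice` (§3: the bound by the degree).  THEOREMS ONLY: no definition, no instance,
no named fact (net Literature debt `0`).  `gens_R(I)` is Mathlib's `Submodule.spanFinrank`; `I/𝔭I` is
`↥I ⧸ 𝔭 • ⊤` over `R ⧸ 𝔭` (`CMOrderCohenMacaulayTypeOne`, `CMOrderLocalMinimalGenerators`).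

## Source, VERBATIM

S. Marseglia, *Cohen-Macaulay type of orders, generators and ideal classes*, J. Algebra 658 (2024) 247–276
[Marseglia2024CMType] (arXiv:2206.03758, chunk p0010, §4): "Lemma 4.2. Let `S` be an order and `I` be a fractional
`S`-ideal. Then `gens_S(I) ≤ max {2, dim_{S/𝔭}(I/𝔭I) : 𝔭 prime of S}`, with equality if and only if `gens_S(I) ≠ 1`,
that is, `I` is not principal. Proof. By Nakayama's Lemma, for a prime `𝔭` of `S`, we have the equality
`gens_{S_𝔭}(I_𝔭) = dim_{S/𝔭}(I/𝔭I)`. Put `m = max{gens_{S_𝔭}(I_𝔭) : 𝔭 a prime of S}`. First we consider the case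
`m > 1`. Construct `b₁` in the following way. Put `𝒜 = {𝔭 : gens_{S_𝔭}(I_𝔭) = m}` and consider the natural surjection
`π : I → ⊕_{𝔭 ∈ 𝒜} I/𝔭I`. Observe that `𝒜` is a finite set […]. Pick `b₁ ∈ I` such that `π(b₁)` is non-zero in each
coordinate. […] Now consider the set `𝓑 = {𝔭 : I ≠ b₁S + 𝔭I}`. Observe that `𝓑` is finite since it coincides with
the support of the finite length `S`-module `I/b₁S`. For every `𝔭 ∈ 𝓑` define vectors `b_{1,𝔭}, …, b_{m,𝔭}` of `I/𝔭I`
in the following way: let `b_{1,𝔭}` the image of `b₁` via the surjection `I → I/𝔭I` and then take vectors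
`b_{2,𝔭}, …, b_{m,𝔭}`, possibly with repetitions, such that `b_{1,𝔭}, …, b_{m,𝔭}` generate `I/𝔭I` over `S/𝔭`. Note
that `𝒜 ⊆ 𝓑`, so `b_{1,𝔭} ≠ 0` for all `𝔭` such that the dimension of `I/𝔭I` is maximal, that is, equal to `m`.
Using the isomorphism `I/(I·∏_{𝔭∈𝓑} 𝔭) ≃ ∏_{𝔭∈𝓑} I/𝔭I` for `i = 2, …, m` pick `b_i` in `I` such that it reduces to
`b_{i,𝔭}` modulo `𝔭I` for each prime `𝔭 ∈ 𝓑`. One checks using localization that `b₁, …, b_m` is a set of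
generators of `I` over `S`: if `𝔭` is in `𝓑` then this is the case by construction, while if `𝔭` is not in `𝓑`
then `b₁` is a local generator at `𝔭`. Now we consider the case when `m = 1`. […] Then, again by localization,
one checks that `I = b₁S + b₂S`."

## What is formalised

* §1 (tools): **`NumberRing.exists_fin_span_insert_eq_top`** (linear algebra: in a vector space of dimension
  `≤ n+1` a vector `v`, nonzero when the dimension is `n+1`, is completed to a spanning family by `n` vectors — the
  choice of `b_{2,𝔭}, …, b_{m,𝔭}`), **`exists_mem_forall_sub_mem_smul`** (Chinese remainder in `I`: an element of
  `I` with prescribed classes modulo `𝔭I` at finitely many maximal ideals), **`le_span_sup_smul_of_span_mkQ_eq_top`**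
  (if the classes of `s ⊆ I` span `I/𝔭I` then `I ⊆ Rs + 𝔭I`), **`finite_setOf_span_coe_ne_span_singleton`** (for
  `0 ≠ b ∈ I`, `I_𝔭 = bR_𝔭` for all but finitely many maximal `𝔭` — the finiteness of `𝓑`),
  `exists_mem_ne_zero_forall_not_mem_smul` (the choice of `b₁`).
* §1 (the lemma): **`NumberRing.spanFinrank_le_of_forall_finrank_quotient_le`** (LEMMA 4.2, `≤`: if
  `dim_{R/𝔭} I/𝔭I ≤ n+1` for every maximal `𝔭` and `n ≥ 1` then `gens_R(I) ≤ n+1`), **`spanFinrank_le_two_of_isUnit`**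
  (invertible `⟹` two generators), `two_le_spanFinrank_of_not_isPrincipal`, and the equality cases
  **`spanFinrank_eq_of_forall_finrank_quotient_le`** (`gens_R(I) = m` when `m = max_𝔭 dim I/𝔭I ≥ 2`) and
  **`spanFinrank_eq_two_of_isUnit_of_not_isPrincipal`**.
* §2 (`𝔯 = endOrder ρ`): `EndOrder.spanFinrank_le_of_forall_finrank_quotient_le`,
  **`EndOrder.spanFinrank_le_two_of_isUnit`** («every invertible fractional ideal of an order is generated by two
  elements»), `EndOrder.spanFinrank_eq_of_forall_finrank_quotient_le`, `EndOrder.spanFinrank_eq_two_of_isUnit_of_not_isPrincipal`.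
* §3 (`𝔯 = endOrder (M_μ)`): `CMTypeLattice.spanFinrank_coe_le_card` (`gens_𝔯(I) ≤ [K:ℚ]`, from a `ℤ`-basis of `I`)
  and `CMTypeLattice.finrank_quotient_smul_top_le_card` (`dim_{𝔯/𝔭} I/𝔭I ≤ [K:ℚ]`).
-/

noncomputable section

open scoped nonZeroDivisors NumberField
open NumberField Module FractionalIdeal

namespace Literature.NumberTheory.ComplexMultiplication

namespace NumberRing

/-! ## §1a Tools: linear algebra, Chinese remainder in `I`, classes spanning `I/𝔭I`, finiteness of `𝓑` -/

/-- **The choice of `b_{2,𝔭}, …, b_{m,𝔭}`** («take vectors `b_{2,𝔭}, …, b_{m,𝔭}`, possibly with repetitions, such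
that `b_{1,𝔭}, …, b_{m,𝔭}` generate `I/𝔭I`»): in a vector space of dimension `≤ n + 1`, a vector `v` which is
nonzero whenever the dimension equals `n + 1` can be completed by `n` vectors to a spanning family (exchange of a
basis vector against `v`). [cite: Marseglia2024CMType, §4 Lemma 4.2 (proof), p. 10] -/
theorem exists_fin_span_insert_eq_top {F V : Type*} [DivisionRing F] [AddCommGroup V] [Module F V]
    [Module.Finite F V] {n : ℕ} (hV : Module.finrank F V ≤ n + 1) {v : V}
    (hv : Module.finrank F V = n + 1 → v ≠ 0) :
    ∃ t : Fin n → V, Submodule.span F (insert v (Set.range t)) = ⊤ := by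
  classical
  -- it suffices to find `d' ≤ n` vectors; then pad with zeros
  suffices hsuff : ∃ d' ≤ n, ∃ t : Fin d' → V, Submodule.span F (insert v (Set.range t)) = ⊤ by
    obtain ⟨d', hd'n, t, ht⟩ := hsuff
    refine ⟨fun j ↦ if h : (j : ℕ) < d' then t ⟨j, h⟩ else 0, ?_⟩
    rw [eq_top_iff, ← ht, Submodule.span_le]
    rintro x (rfl | ⟨j, rfl⟩)
    · exact Submodule.subset_span (Set.mem_insert _ _)
    · refine Submodule.subset_span (Set.mem_insert_of_mem _ ⟨⟨j, lt_of_lt_of_le j.2 hd'n⟩, ?_⟩)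
      simp [j.2]
  by_cases hv0 : v = 0
  · -- `dim V ≤ n`: a basis does it
    have hdn : Module.finrank F V ≤ n := by
      rcases Nat.lt_or_ge (Module.finrank F V) (n + 1) with h | h
      · omega
      · exact absurd hv0 (hv (le_antisymm hV h))
    refine ⟨Module.finrank F V, hdn, Module.finBasis F V, ?_⟩
    rw [eq_top_iff, ← (Module.finBasis F V).span_eq]
    exact Submodule.span_mono (Set.subset_insert _ _)
  · -- exchange: `v = Σ cᵢ wᵢ` with `c_k ≠ 0`, and `w_k ∈ span (v, (w_i)_{i ≠ k})`
    haveI : Nontrivial V := nontrivial_of_ne v 0 hv0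
    obtain ⟨d', hd'⟩ : ∃ d', Module.finrank F V = d' + 1 :=
      Nat.exists_eq_succ_of_ne_zero (Module.finrank_pos (R := F) (M := V)).ne'
    let w : Basis (Fin (d' + 1)) F V := (Module.finBasis F V).reindex (finCongr hd')
    obtain ⟨k, hk⟩ : ∃ k, w.repr v k ≠ 0 := by
      by_contra h
      push Not at h
      exact hv0 (w.repr.map_eq_zero_iff.1 (Finsupp.ext h))
    refine ⟨d', by omega, fun j ↦ w (k.succAbove j), ?_⟩
    rw [eq_top_iff, ← w.span_eq, Submodule.span_le]
    rintro _ ⟨i, rfl⟩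
    by_cases hik : i = k
    · subst hik
      -- `c_i • w_i = v - Σ_{j} c_{σ j} w_{σ j}`
      have hsum : w.repr v i • w i = v - ∑ j : Fin d', w.repr v (i.succAbove j) • w (i.succAbove j) := by
        rw [eq_sub_iff_add_eq, ← Fin.sum_univ_succAbove (fun l ↦ w.repr v l • w l) i, w.sum_repr]
      have hmem : w.repr v i • w i ∈ Submodule.span F (insert v (Set.range fun j ↦ w (i.succAbove j))) := by
        rw [hsum]
        refine Submodule.sub_mem _ (Submodule.subset_span (Set.mem_insert _ _))
          (Submodule.sum_mem _ fun j _ ↦ Submodule.smul_mem _ _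
            (Submodule.subset_span (Set.mem_insert_of_mem _ ⟨j, rfl⟩)))
      have := Submodule.smul_mem _ (w.repr v i)⁻¹ hmem
      rwa [smul_smul, inv_mul_cancel₀ hk, one_smul] at this
    · obtain ⟨j, rfl⟩ := Fin.exists_succAbove_eq hik
      exact Submodule.subset_span (Set.mem_insert_of_mem _ ⟨j, rfl⟩)

/-- **Chinese remainder inside `I`** («Using the isomorphism `I/(I·∏_{𝔭∈𝓑} 𝔭) ≃ ∏_{𝔭∈𝓑} I/𝔭I` […] pick `b_i` in `I`
such that it reduces to `b_{i,𝔭}` modulo `𝔭I` for each prime `𝔭 ∈ 𝓑`»): for finitely many maximal ideals `𝔭` and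
elements `c_𝔭 ∈ I` there is `b ∈ I` with `b − c_𝔭 ∈ 𝔭I` for all of them (`b = Σ e_𝔭 c_𝔭` with Chinese-remainder
idempotents `e_𝔭`). [cite: Marseglia2024CMType, §4 Lemma 4.2 (proof), p. 10] -/
theorem exists_mem_forall_sub_mem_smul {R M : Type*} [CommRing R] [AddCommGroup M] [Module R M]
    (N : Submodule R M) (𝓑 : Finset (MaximalSpectrum R)) (c : MaximalSpectrum R → M)
    (hc : ∀ 𝔭 ∈ 𝓑, c 𝔭 ∈ N) : ∃ b ∈ N, ∀ 𝔭 ∈ 𝓑, b - c 𝔭 ∈ 𝔭.asIdeal • N := by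
  classical
  have hcop : Pairwise (Function.onFun IsCoprime fun 𝔭 : 𝓑 ↦ (𝔭 : MaximalSpectrum R).asIdeal) :=
    fun 𝔭 𝔮 hne ↦ Ideal.isCoprime_iff_sup_eq.2 (𝔭.1.isMaximal.coprime_of_ne 𝔮.1.isMaximal
      fun h ↦ hne (Subtype.ext (MaximalSpectrum.ext h)))
  -- idempotents `e_𝔭 ≡ δ_{𝔭𝔮} (mod 𝔮)`
  have he : ∀ 𝔭 : 𝓑, ∃ e : R, ∀ 𝔮 : 𝓑, e - (if 𝔮 = 𝔭 then 1 else 0) ∈ (𝔮 : MaximalSpectrum R).asIdeal :=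
    fun 𝔭 ↦ Ideal.exists_forall_sub_mem_ideal hcop _
  choose e he using he
  refine ⟨∑ 𝔭 : 𝓑, e 𝔭 • c 𝔭, N.sum_mem fun 𝔭 _ ↦ N.smul_mem _ (hc _ 𝔭.2), fun 𝔭 h𝔭 ↦ ?_⟩
  rw [← Finset.sum_erase_add _ _ (Finset.mem_univ (⟨𝔭, h𝔭⟩ : 𝓑)), add_sub_assoc]
  refine Submodule.add_mem _ (Submodule.sum_mem _ fun 𝔮 h𝔮 ↦ ?_) ?_
  · -- `𝔮 ≠ 𝔭`: `e_𝔮 ∈ 𝔭`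
    have h := he 𝔮 ⟨𝔭, h𝔭⟩
    rw [if_neg (Finset.ne_of_mem_erase h𝔮).symm, sub_zero] at h
    exact Submodule.smul_mem_smul h (hc _ 𝔮.2)
  · -- `e_𝔭 c_𝔭 - c_𝔭 = (e_𝔭 - 1) c_𝔭`
    have h := he ⟨𝔭, h𝔭⟩ ⟨𝔭, h𝔭⟩
    rw [if_pos rfl] at h
    have : e ⟨𝔭, h𝔭⟩ • c 𝔭 - c 𝔭 = (e ⟨𝔭, h𝔭⟩ - 1) • c 𝔭 := by rw [sub_smul, one_smul]
    rw [this]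
    exact Submodule.smul_mem_smul h (hc _ h𝔭)

section AnyDomain

variable {R : Type*} [CommRing R] [IsDomain R] {K : Type*} [Field K] [Algebra R K] [IsFractionRing R K]

omit [IsDomain R] [IsFractionRing R K] in
/-- **If the classes of `s ⊆ I` span the `R/𝔭`-vector space `I/𝔭I` then `I ⊆ Rs + 𝔭I`** («`b_{1,𝔭}, …, b_{m,𝔭}`
generate `I/𝔭I` over `S/𝔭`» ⟹ Nakayama applies at `𝔭`). [cite: Marseglia2024CMType, §4 Lemma 4.2 (proof), p. 10]
[cite: Matsumura1987, §2 Thm. 2.3 (i), p. 8] -/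
theorem le_span_sup_smul_of_span_mkQ_eq_top (𝔭 : Ideal R) (I : Submodule R K) (S : Set I)
    (h : Submodule.span (R ⧸ 𝔭) ((𝔭 • ⊤ : Submodule R I).mkQ '' S) = ⊤) :
    I ≤ Submodule.span R (((↑) : I → K) '' S) ⊔ 𝔭 • I := by
  haveI : IsScalarTower R (R ⧸ 𝔭) (I ⧸ (𝔭 • ⊤ : Submodule R I)) :=
    IsScalarTower.of_algebraMap_smul fun _ _ ↦ rfl
  intro y hy
  have hy' : (𝔭 • ⊤ : Submodule R I).mkQ ⟨y, hy⟩ ∈ Submodule.span R ((𝔭 • ⊤ : Submodule R I).mkQ '' S) := by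
    rw [← Submodule.restrictScalars_span R (R ⧸ 𝔭) Ideal.Quotient.mk_surjective ((𝔭 • ⊤ : Submodule R I).mkQ '' S),
      Submodule.restrictScalars_mem, h]
    exact Submodule.mem_top
  rw [← Submodule.map_span] at hy'
  obtain ⟨z, hz, hzy⟩ := Submodule.mem_map.1 hy'
  have hzy' : ((z - ⟨y, hy⟩ : I) : K) ∈ 𝔭 • I :=
    (mem_smul_top_iff 𝔭 I _).1 ((Submodule.Quotient.eq _).1 hzy)
  have hzS : (z : K) ∈ Submodule.span R (((↑) : I → K) '' S) := by
    have := Submodule.mem_map_of_mem (f := I.subtype) hz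
    rwa [Submodule.map_span, Submodule.coe_subtype] at this
  have hyz : y = (z : K) - ((z - ⟨y, hy⟩ : I) : K) := by
    simp only [Submodule.coe_sub, sub_sub_cancel]
  rw [hyz]
  exact Submodule.sub_mem _ (Submodule.mem_sup_left hzS) (Submodule.mem_sup_right hzy')

/-- **The finiteness of `𝓑 = {𝔭 : I ≠ b₁S + 𝔭I}`**: for `0 ≠ b ∈ I`, `I_𝔭 = bR_𝔭` for all but finitely many maximal
ideals `𝔭` of a noetherian one-dimensional domain («`𝓑` is finite since it coincides with the support of the finite
length `S`-module `I/b₁S`»; here: `(b⁻¹I)_𝔭 = R_𝔭` for almost all `𝔭`, `CMOrderInvertibleIdealLocalization`).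
[cite: Marseglia2024CMType, §4 Lemma 4.2 (proof), p. 10] -/
theorem finite_setOf_span_coe_ne_span_singleton [IsNoetherianRing R] [Ring.DimensionLEOne R]
    {I : FractionalIdeal R⁰ K} (hI0 : I ≠ 0) {b : K} (hb0 : b ≠ 0) :
    {𝔭 : MaximalSpectrum R |
      Submodule.span (Localization.subalgebra.ofField K 𝔭.asIdeal.primeCompl
          𝔭.asIdeal.primeCompl_le_nonZeroDivisors) (I : Set K) ≠
        Submodule.span (Localization.subalgebra.ofField K 𝔭.asIdeal.primeCompl
          𝔭.asIdeal.primeCompl_le_nonZeroDivisors) {b}}.Finite := by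
  have hL0 : spanSingleton R⁰ b⁻¹ * I ≠ 0 := fun hL ↦ hI0 (by
    rw [← one_mul I, ← spanSingleton_one, ← mul_inv_cancel₀ hb0, ← spanSingleton_mul_spanSingleton, mul_assoc,
      hL, mul_zero])
  refine (finite_setOf_span_coe_ne_span_one (K := K) hL0).subset fun 𝔭 h𝔭 hL ↦ h𝔭 ?_
  set A := Localization.subalgebra.ofField K 𝔭.asIdeal.primeCompl 𝔭.asIdeal.primeCompl_le_nonZeroDivisors with hA
  rw [span_coe_mul, span_coe_spanSingleton] at hL
  -- `span ↑I = b·(b⁻¹·span ↑I) = b·R_𝔭`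
  calc Submodule.span A (I : Set K)
      = Submodule.span A {b} * (Submodule.span A {b⁻¹} * Submodule.span A (I : Set K)) := by
        rw [← mul_assoc, Submodule.span_mul_span, Set.singleton_mul_singleton, mul_inv_cancel₀ hb0,
          ← Submodule.one_eq_span, one_mul]
    _ = Submodule.span A {b} := by rw [hL, ← Submodule.one_eq_span, mul_one]

omit [IsDomain R] in
/-- **The choice of `b₁`** («Pick `b₁ ∈ I` such that `π(b₁)` is non-zero in each coordinate»): for finitely many
maximal ideals `𝔭` there is `0 ≠ b₁ ∈ I` with `b₁ ∉ 𝔭I` for all of them (`I ≠ 0` finitely generated; NAK gives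
`𝔭I ≠ I`, then Chinese remainder). [cite: Marseglia2024CMType, §4 Lemma 4.2 (proof), p. 10] -/
theorem exists_mem_ne_zero_forall_not_mem_smul {I : Submodule R K} (hI : I.FG) (h0 : I ≠ ⊥)
    (𝒜 : Finset (MaximalSpectrum R)) : ∃ b ∈ I, b ≠ 0 ∧ ∀ 𝔭 ∈ 𝒜, b ∉ 𝔭.asIdeal • I := by
  -- at each `𝔭`, some `c_𝔭 ∈ I ∖ 𝔭I`
  have hc : ∀ 𝔭 : MaximalSpectrum R, ∃ c ∈ I, c ∉ 𝔭.asIdeal • I := fun 𝔭 ↦ by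
    have hne : 𝔭.asIdeal • I ≠ I := smul_ne_self_of_fg 𝔭.isMaximal.ne_top hI h0
    by_contra h
    push Not at h
    exact hne (le_antisymm Submodule.smul_le_right h)
  choose c hcI hc using hc
  obtain ⟨b, hbI, hb⟩ := exists_mem_forall_sub_mem_smul I 𝒜 c fun 𝔭 _ ↦ hcI 𝔭
  have hb' : ∀ 𝔭 ∈ 𝒜, b ∉ 𝔭.asIdeal • I := fun 𝔭 h𝔭 hb𝔭 ↦ hc 𝔭 (by
    have := Submodule.sub_mem _ hb𝔭 (hb 𝔭 h𝔭)
    rwa [sub_sub_cancel] at this)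
  by_cases hb0 : b = 0
  · -- then `𝒜 = ∅`: any nonzero element of `I` does it
    obtain ⟨b', hb'I, hb'0⟩ := Submodule.exists_mem_ne_zero_of_ne_bot h0
    exact ⟨b', hb'I, hb'0, fun 𝔭 h𝔭 _ ↦ hb' 𝔭 h𝔭 (hb0 ▸ Submodule.zero_mem _)⟩
  · exact ⟨b, hbI, hb0, hb'⟩

/-! ## §1b LEMMA 4.2 -/

/-- **MARSEGLIA 2024 LEMMA 4.2 (`≤`): if `dim_{R/𝔭} I/𝔭I ≤ n + 1` for every maximal ideal `𝔭` (and `n ≥ 1`) then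
the nonzero fractional ideal `I` of the noetherian one-dimensional domain `R` is generated by `n + 1` elements,
`gens_R(I) ≤ n + 1`.**  Proof as printed: `b₁ ∈ I` nonzero modulo `𝔭I` at the (finitely many) primes where `I_𝔭`
is not `b₀R_𝔭`; the finite set `𝓑` of primes with `I_𝔭 ≠ b₁R_𝔭`; for `𝔭 ∈ 𝓑` classes `b_{2,𝔭}, …, b_{n+1,𝔭}`
completing the class of `b₁` to a spanning family of `I/𝔭I`; Chinese-remainder lifts `b₂, …, b_{n+1} ∈ I`; then
`I_𝔭 = (b₁, …, b_{n+1})R_𝔭` for every `𝔭` (Nakayama at `𝔭 ∈ 𝓑`, `b₁` alone at `𝔭 ∉ 𝓑`), so `I = Σ bᵢR` by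
`I = ⋂_𝔭 I_𝔭`. [cite: Marseglia2024CMType, §4 Lemma 4.2 and proof, p. 10] -/
theorem spanFinrank_le_of_forall_finrank_quotient_le [IsNoetherianRing R] [Ring.DimensionLEOne R]
    {I : FractionalIdeal R⁰ K} (hI : I ≠ 0) {n : ℕ} (hn : 1 ≤ n)
    (h : ∀ 𝔭 : MaximalSpectrum R, Module.finrank (R ⧸ 𝔭.asIdeal)
      ((I : Submodule R K) ⧸ (𝔭.asIdeal • ⊤ : Submodule R (I : Submodule R K))) ≤ n + 1) :
    (I : Submodule R K).spanFinrank ≤ n + 1 := by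
  classical
  have hfg : (I : Submodule R K).FG := fg_of_isNoetherianRing le_rfl I
  have h0 : (I : Submodule R K) ≠ ⊥ := fun hb ↦ hI (coeToSubmodule_eq_bot.1 hb)
  -- Step 0: a nonzero `b₀ ∈ I` and the finite set `𝒮 ⊇ 𝒜` of primes with `I_𝔭 ≠ b₀R_𝔭`
  obtain ⟨b₀, hb₀I, hb₀0⟩ := Submodule.exists_mem_ne_zero_of_ne_bot h0
  set 𝒮 := (finite_setOf_span_coe_ne_span_singleton hI hb₀0).toFinset with h𝒮
  -- Step 1: `b₁ ∈ I`, nonzero, `b₁ ∉ 𝔭I` for `𝔭 ∈ 𝒮`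
  obtain ⟨b₁, hb₁I, hb₁0, hb₁𝒮⟩ := exists_mem_ne_zero_forall_not_mem_smul hfg h0 𝒮
  -- Step 2: the finite set `𝓑 ⊇ {𝔭 : I ≠ b₁R + 𝔭I}`
  set 𝓑 := (finite_setOf_span_coe_ne_span_singleton hI hb₁0).toFinset with h𝓑
  -- Step 3: local spanning families `b₁, t_𝔭 1, …, t_𝔭 n` of `I/𝔭I`
  have ht : ∀ 𝔭 : MaximalSpectrum R, ∃ t : Fin n → (I : Submodule R K),
      Submodule.span (R ⧸ 𝔭.asIdeal) ((𝔭.asIdeal • ⊤ : Submodule R (I : Submodule R K)).mkQ ''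
        insert ⟨b₁, hb₁I⟩ (Set.range t)) = ⊤ := by
    intro 𝔭
    letI : Field (R ⧸ 𝔭.asIdeal) := Ideal.Quotient.field 𝔭.asIdeal
    haveI := finite_quotient_smul_top (K := K) 𝔭.asIdeal hfg
    -- the class of `b₁` is nonzero where the dimension is maximal
    have hv : Module.finrank (R ⧸ 𝔭.asIdeal)
        ((I : Submodule R K) ⧸ (𝔭.asIdeal • ⊤ : Submodule R (I : Submodule R K))) = n + 1 →
        Submodule.Quotient.mk (p := (𝔭.asIdeal • ⊤ : Submodule R (I : Submodule R K))) ⟨b₁, hb₁I⟩ ≠ 0 := by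
      intro hd
      have h𝔭𝒮 : 𝔭 ∈ 𝒮 := by
        by_contra h𝔭
        rw [h𝒮, Set.Finite.mem_toFinset, Set.mem_setOf_eq, not_not] at h𝔭
        haveI := 𝔭.isMaximal
        have h1 := (isPrincipal_span_coe_iff_finrank_quotient_eq_one 𝔭.asIdeal hfg h0).1 ⟨⟨b₀, h𝔭⟩⟩
        omega
      rw [Ne, Submodule.Quotient.mk_eq_zero, mem_smul_top_iff]
      exact hb₁𝒮 𝔭 h𝔭𝒮
    obtain ⟨t, ht⟩ := exists_fin_span_insert_eq_top (h 𝔭) hv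
    choose u hu using fun j ↦ Submodule.Quotient.mk_surjective
      (𝔭.asIdeal • ⊤ : Submodule R (I : Submodule R K)) (t j)
    refine ⟨u, ?_⟩
    rw [Set.image_insert_eq, ← Set.range_comp]
    have hcomp : ((𝔭.asIdeal • ⊤ : Submodule R (I : Submodule R K)).mkQ ∘ u) = t := funext fun j ↦ hu j
    rw [hcomp]
    exact ht
  choose t ht using ht
  -- Step 4: Chinese-remainder lifts `b j ∈ I`, `b j ≡ t 𝔭 j (mod 𝔭I)` for `𝔭 ∈ 𝓑`
  have hb : ∀ j : Fin n, ∃ b ∈ (I : Submodule R K), ∀ 𝔭 ∈ 𝓑,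
      b - (t 𝔭 j : K) ∈ 𝔭.asIdeal • (I : Submodule R K) := fun j ↦
    exists_mem_forall_sub_mem_smul (I : Submodule R K) 𝓑 (fun 𝔭 ↦ (t 𝔭 j : K)) fun 𝔭 _ ↦ (t 𝔭 j).2
  choose b hbI hb using hb
  -- Step 5: `s = {b₁, b 1, …, b n}` generates `I` locally everywhere
  set s : Set K := insert b₁ (Set.range b) with hs
  have hsI : s ⊆ (I : Submodule R K) := by
    rintro x (rfl | ⟨j, rfl⟩)
    · exact hb₁I
    · exact hbI j
  have hloc : ∀ 𝔭 : MaximalSpectrum R,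
      (I : Submodule R K) ≤ Submodule.span R s ⊔ 𝔭.asIdeal • (I : Submodule R K) := by
    intro 𝔭
    by_cases h𝔭 : 𝔭 ∈ 𝓑
    · -- «if `𝔭` is in `𝓑` then this is the case by construction»
      refine (le_span_sup_smul_of_span_mkQ_eq_top 𝔭.asIdeal _ _ (ht 𝔭)).trans (sup_le ?_ le_sup_right)
      refine Submodule.span_le.2 ?_
      rintro _ ⟨z, hz, rfl⟩
      rcases hz with rfl | ⟨j, rfl⟩
      · exact Submodule.mem_sup_left (Submodule.subset_span (Set.mem_insert _ _))
      · have : ((t 𝔭 j : (I : Submodule R K)) : K) = b j - (b j - (t 𝔭 j : K)) := by ring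
        rw [this]
        exact Submodule.sub_mem _
          (Submodule.mem_sup_left (Submodule.subset_span (Set.mem_insert_of_mem _ ⟨j, rfl⟩)))
          (Submodule.mem_sup_right (hb j 𝔭 h𝔭))
    · -- «if `𝔭` is not in `𝓑` then `b₁` is a local generator at `𝔭`»
      rw [h𝓑, Set.Finite.mem_toFinset, Set.mem_setOf_eq, not_not] at h𝔭
      haveI := 𝔭.isMaximal
      exact (le_span_singleton_sup_smul_of_span_coe_eq_span_singleton 𝔭.asIdeal h𝔭).trans
        (sup_le_sup_right (Submodule.span_mono (Set.singleton_subset_iff.2 (Set.mem_insert _ _))) _)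
  -- hence `I = Rs` («One checks using localization that `b₁, …, b_m` is a set of generators of `I`»)
  have hIs : (I : Submodule R K) = Submodule.span R s := by
    refine le_antisymm (fun x hx ↦ ?_) (Submodule.span_le.2 hsI)
    rw [mem_iff_forall_mem_span (Submodule.span R s) x]
    intro 𝔭
    haveI := 𝔭.isMaximal
    rw [Submodule.span_span_of_tower, ← span_coe_eq_span_of_le_span_sup_smul 𝔭.asIdeal hfg hsI (hloc 𝔭)]
    exact Submodule.subset_span hx
  -- and count
  have hcard : s.ncard ≤ n + 1 := by
    have hrange : (Set.range b).ncard ≤ n := by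
      rw [← Set.image_univ, ← Finset.coe_univ, ← Finset.coe_image, Set.ncard_coe_finset]
      exact Finset.card_image_le.trans (by simp)
    exact (Set.ncard_insert_le b₁ (Set.range b)).trans (by omega)
  rw [hIs]
  exact (Submodule.spanFinrank_span_le_ncard_of_finite ((Set.finite_range b).insert b₁)).trans hcard

/-- **Every invertible fractional ideal of a noetherian one-dimensional domain is generated by two elements**
(`dim I/𝔭I = 1` everywhere, so `gens_R(I) ≤ max{2, 1} = 2`; for a Dedekind domain this is the classical «ideals are
`1½`-generated»). [cite: Marseglia2024CMType, §4 Lemma 4.2 with §2.5 Lemma 2.12 ((i)⟺(iii)), pp. 7, 10] -/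
theorem spanFinrank_le_two_of_isUnit [IsNoetherianRing R] [Ring.DimensionLEOne R]
    {I : FractionalIdeal R⁰ K} (hI : IsUnit I) : (I : Submodule R K).spanFinrank ≤ 2 := by
  have hI0 : I ≠ 0 := hI.ne_zero
  exact spanFinrank_le_of_forall_finrank_quotient_le hI0 le_rfl fun 𝔭 ↦
    ((isUnit_iff_forall_finrank_quotient_eq_one hI0).1 hI 𝔭).le.trans (by norm_num)

omit [IsDomain R] [IsFractionRing R K] in
/-- **`gens_R(I) ≥ 2` unless `I` is principal** («with equality if and only if `gens_S(I) ≠ 1`, that is, `I` is not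
principal»; `gens = 1 ⟺` principal and nonzero is Mathlib's `Submodule.spanFinrank_eq_one_iff`).
[cite: Marseglia2024CMType, §4 Lemma 4.2, p. 10] -/
theorem two_le_spanFinrank_of_not_isPrincipal {I : Submodule R K} (hI : I.FG) (h0 : I ≠ ⊥)
    (hnp : ¬ I.IsPrincipal) : 2 ≤ I.spanFinrank := by
  have h1 : I.spanFinrank ≠ 1 := fun h ↦ hnp ((Submodule.spanFinrank_eq_one_iff I).1 h).1
  have h0' : I.spanFinrank ≠ 0 := fun h ↦ h0 ((Submodule.spanFinrank_eq_zero_iff_eq_bot hI).1 h)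
  omega

/-- **MARSEGLIA 2024 LEMMA 4.2, the equality for `m ≥ 2`: if `m = max_𝔭 dim_{R/𝔭} I/𝔭I ≥ 2` then
`gens_R(I) = m`** (`≤` above; `≥` since `dim I/𝔭I ≤ gens_R(I)` at the maximising prime,
`CMOrderLocalMinimalGenerators`). [cite: Marseglia2024CMType, §4 Lemma 4.2, p. 10] -/
theorem spanFinrank_eq_of_forall_finrank_quotient_le [IsNoetherianRing R] [Ring.DimensionLEOne R]
    {I : FractionalIdeal R⁰ K} (hI : I ≠ 0) {m : ℕ} (hm : 2 ≤ m)
    (h : ∀ 𝔭 : MaximalSpectrum R, Module.finrank (R ⧸ 𝔭.asIdeal)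
      ((I : Submodule R K) ⧸ (𝔭.asIdeal • ⊤ : Submodule R (I : Submodule R K))) ≤ m)
    (hmax : ∃ 𝔭 : MaximalSpectrum R, Module.finrank (R ⧸ 𝔭.asIdeal)
      ((I : Submodule R K) ⧸ (𝔭.asIdeal • ⊤ : Submodule R (I : Submodule R K))) = m) :
    (I : Submodule R K).spanFinrank = m := by
  obtain ⟨n, rfl⟩ : ∃ n, m = n + 1 := Nat.exists_eq_succ_of_ne_zero (by omega)
  refine le_antisymm (spanFinrank_le_of_forall_finrank_quotient_le hI (by omega) h) ?_
  obtain ⟨𝔭, h𝔭⟩ := hmax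
  haveI := 𝔭.isMaximal
  rw [← h𝔭]
  exact finrank_quotient_smul_top_le_spanFinrank 𝔭.asIdeal (fg_of_isNoetherianRing le_rfl I)

/-- **MARSEGLIA 2024 LEMMA 4.2, the equality for `m = 1`: an invertible but non-principal fractional ideal needs
exactly two generators, `gens_R(I) = 2 = max{2, 1}`.** [cite: Marseglia2024CMType, §4 Lemma 4.2, p. 10] -/
theorem spanFinrank_eq_two_of_isUnit_of_not_isPrincipal [IsNoetherianRing R] [Ring.DimensionLEOne R]
    {I : FractionalIdeal R⁰ K} (hI : IsUnit I) (hnp : ¬ (I : Submodule R K).IsPrincipal) :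
    (I : Submodule R K).spanFinrank = 2 :=
  le_antisymm (spanFinrank_le_two_of_isUnit hI) (two_le_spanFinrank_of_not_isPrincipal
    (fg_of_isNoetherianRing le_rfl I) (fun hb ↦ hI.ne_zero (coeToSubmodule_eq_bot.1 hb)) hnp)

end AnyDomain

end NumberRing

/-! ## §2 The order `𝔯 = endOrder ρ`: invertible ideals are `2`-generated; `gens = max{2, max dim I/𝔭I}` -/

namespace EndOrder

variable {K : Type} [Field K] [NumberField K]
variable {ι : Type} [Fintype ι] [DecidableEq ι] [Nonempty ι] {ρ : K →ₐ[ℚ] Matrix ι ι ℚ}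
variable [IsFractionRing (endOrder ρ) K]

/-- **LEMMA 4.2 (`≤`) for the order `𝔯 = endOrder ρ` of a number field of any degree: if `dim_{𝔯/𝔭} I/𝔭I ≤ n+1` at
every maximal `𝔭` (`n ≥ 1`) then `I` is generated by `n + 1` elements.** [cite: Marseglia2024CMType, §4 Lemma 4.2,
p. 10] -/
theorem spanFinrank_le_of_forall_finrank_quotient_le {I : FractionalIdeal (endOrder ρ)⁰ K} (hI : I ≠ 0)
    {n : ℕ} (hn : 1 ≤ n)
    (h : ∀ 𝔭 : MaximalSpectrum (endOrder ρ), Module.finrank (endOrder ρ ⧸ 𝔭.asIdeal)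
      ((I : Submodule (endOrder ρ) K) ⧸
        (𝔭.asIdeal • ⊤ : Submodule (endOrder ρ) (I : Submodule (endOrder ρ) K))) ≤ n + 1) :
    (I : Submodule (endOrder ρ) K).spanFinrank ≤ n + 1 :=
  haveI := CMTypeLattice.isNoetherianRing_endOrder ρ
  haveI := CMTypeLattice.dimensionLEOne_endOrder ρ
  NumberRing.spanFinrank_le_of_forall_finrank_quotient_le hI hn h

/-- **Every invertible fractional ideal of the order `𝔯` — in particular every fractional ideal when `𝔯 = 𝓞_K` is
the maximal order — is generated by two elements.** [cite: Marseglia2024CMType, §4 Lemma 4.2 with §2.5 Lemma 2.12,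
pp. 7, 10] -/
theorem spanFinrank_le_two_of_isUnit {I : FractionalIdeal (endOrder ρ)⁰ K} (hI : IsUnit I) :
    (I : Submodule (endOrder ρ) K).spanFinrank ≤ 2 :=
  haveI := CMTypeLattice.isNoetherianRing_endOrder ρ
  haveI := CMTypeLattice.dimensionLEOne_endOrder ρ
  NumberRing.spanFinrank_le_two_of_isUnit hI

/-- **LEMMA 4.2, equality (`m ≥ 2`) for the order `𝔯`: `gens_𝔯(I) = max_𝔭 dim_{𝔯/𝔭} I/𝔭I` when this maximum is at
least `2`.** [cite: Marseglia2024CMType, §4 Lemma 4.2, p. 10] -/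
theorem spanFinrank_eq_of_forall_finrank_quotient_le {I : FractionalIdeal (endOrder ρ)⁰ K} (hI : I ≠ 0)
    {m : ℕ} (hm : 2 ≤ m)
    (h : ∀ 𝔭 : MaximalSpectrum (endOrder ρ), Module.finrank (endOrder ρ ⧸ 𝔭.asIdeal)
      ((I : Submodule (endOrder ρ) K) ⧸
        (𝔭.asIdeal • ⊤ : Submodule (endOrder ρ) (I : Submodule (endOrder ρ) K))) ≤ m)
    (hmax : ∃ 𝔭 : MaximalSpectrum (endOrder ρ), Module.finrank (endOrder ρ ⧸ 𝔭.asIdeal)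
      ((I : Submodule (endOrder ρ) K) ⧸
        (𝔭.asIdeal • ⊤ : Submodule (endOrder ρ) (I : Submodule (endOrder ρ) K))) = m) :
    (I : Submodule (endOrder ρ) K).spanFinrank = m :=
  haveI := CMTypeLattice.isNoetherianRing_endOrder ρ
  haveI := CMTypeLattice.dimensionLEOne_endOrder ρ
  NumberRing.spanFinrank_eq_of_forall_finrank_quotient_le hI hm h hmax

/-- **LEMMA 4.2, equality (`m = 1`) for the order `𝔯`: an invertible non-principal fractional `𝔯`-ideal has
`gens_𝔯(I) = 2`.** [cite: Marseglia2024CMType, §4 Lemma 4.2, p. 10] -/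
theorem spanFinrank_eq_two_of_isUnit_of_not_isPrincipal {I : FractionalIdeal (endOrder ρ)⁰ K} (hI : IsUnit I)
    (hnp : ¬ (I : Submodule (endOrder ρ) K).IsPrincipal) : (I : Submodule (endOrder ρ) K).spanFinrank = 2 :=
  haveI := CMTypeLattice.isNoetherianRing_endOrder ρ
  haveI := CMTypeLattice.dimensionLEOne_endOrder ρ
  NumberRing.spanFinrank_eq_two_of_isUnit_of_not_isPrincipal hI hnp

end EndOrder

/-! ## §3 The bound by the degree: `gens_𝔯(I) ≤ [K:ℚ]` and `dim_{𝔯/𝔭} I/𝔭I ≤ [K:ℚ]` -/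

namespace CMTypeLattice

variable {K : Type} [Field K] [NumberField K]
variable {ι : Type} [Fintype ι] [DecidableEq ι] [Nonempty ι] (μ : Basis ι ℚ K)

omit [Nonempty ι] in
/-- **`gens_𝔯(I) ≤ [K:ℚ]`**: a fractional ideal of the order `𝔯 = endOrder (M_μ)` is generated over `𝔯` by the
`[K:ℚ] = #ι` vectors of a `ℤ`-basis (it is a lattice of full rank, `CMLatticeInvertibleIdeals`). [cite:
Marseglia2024CMType, §2.2 («By a `Z`-lattice in `K` we mean a finitely generated sub-`Z`-module […] that contains a
`Q`-basis of `K`»), p. 5] -/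
theorem spanFinrank_coe_le_card {I : FractionalIdeal (endOrder (Algebra.leftMulMatrix μ))⁰ K} (hI : I ≠ 0) :
    (I : Submodule (endOrder (Algebra.leftMulMatrix μ)) K).spanFinrank ≤ Fintype.card ι := by
  classical
  obtain ⟨ν, hν⟩ := exists_basis_span_eq_restrictScalars_coe μ hI
  have hIν : (I : Submodule (endOrder (Algebra.leftMulMatrix μ)) K) =
      Submodule.span (endOrder (Algebra.leftMulMatrix μ)) (Set.range ν) := by
    refine le_antisymm (fun x hx ↦ ?_) (Submodule.span_le.2 fun x hx ↦ ?_)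
    · have hx' : x ∈ Submodule.span ℤ (Set.range ν) := by
        rw [hν]; exact hx
      exact Submodule.span_le_restrictScalars ℤ (endOrder (Algebra.leftMulMatrix μ)) (Set.range ν) hx'
    · have : x ∈ (Submodule.span ℤ (Set.range ν)) := Submodule.subset_span hx
      rw [hν] at this
      exact this
  rw [hIν, ← Set.image_univ, ← Finset.coe_univ, ← Finset.coe_image]
  refine (Submodule.spanFinrank_span_le_ncard_of_finite (Finset.finite_toSet _)).trans ?_
  rw [Set.ncard_coe_finset]
  exact Finset.card_image_le.trans (by simp)

variable [IsFractionRing (endOrder (Algebra.leftMulMatrix μ)) K]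

/-- **`dim_{𝔯/𝔭} I/𝔭I ≤ [K:ℚ]`** for every fractional ideal of the order and every prime `𝔭 ≠ 0` (so all the local
numbers of generators, and the Cohen–Macaulay type `dim 𝔯ᵗ/𝔭𝔯ᵗ`, are at most the degree). [cite:
Marseglia2024CMType, §4 Lemma 4.2 (proof: «`gens_{S_𝔭}(I_𝔭) = dim_{S/𝔭}(I/𝔭I)`»), p. 10; §2.2, p. 5] -/
theorem finrank_quotient_smul_top_le_card {I : FractionalIdeal (endOrder (Algebra.leftMulMatrix μ))⁰ K}
    (hI : I ≠ 0) {𝔭 : Ideal (endOrder (Algebra.leftMulMatrix μ))} [h𝔭 : 𝔭.IsPrime] (h0 : 𝔭 ≠ ⊥) :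
    Module.finrank (endOrder (Algebra.leftMulMatrix μ) ⧸ 𝔭)
        ((I : Submodule (endOrder (Algebra.leftMulMatrix μ)) K) ⧸
          (𝔭 • ⊤ : Submodule (endOrder (Algebra.leftMulMatrix μ))
            (I : Submodule (endOrder (Algebra.leftMulMatrix μ)) K))) ≤ Fintype.card ι :=
  (EndOrder.finrank_quotient_smul_top_le_spanFinrank I h0).trans (spanFinrank_coe_le_card μ hI)

end CMTypeLattice

end Literature.NumberTheory.ComplexMultiplication
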